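import Literature.AlgebraicGeometry.Frobenioids.ArchimedeanFSMIProjection
import HarnessLib

/-!
# Frobenioids II, Proposition 3.4 (vi), FSMI clause: PROOF over an arbitrary base (tower `A`)
# (abc-iut cell, layer L1, node `FrdII:Prop3.4(vi)`; FACT-LIST row F-0823 `ArchFrd.Tower.PropVI_FSMI`)

Mochizuki, *The geometry of Frobenioids II: poly-Frobenioids*, Kyushu J. Math. **62** (2008)
401–460, §3, Proposition 3.4 (vi) p. 30 [cite: MochizukiFrdII2008, Prop 3.4 (vi) p.30]:

> "(vi) … In particular, … FSMI-morphisms of `F` project to either isomorphisms or FSMI-morphisms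
> of `D`." (kurims p. 30 ll. 21–22; "[cf. also assertion (iii)]" belongs to the PROOF, p. 31 l. 29)

PROOF-ONLY file (nothing is defined): the tower `A` (angular Frobenioid, isometries of
`C = C₀ ×_{D₀} D` of arbitrary Frobenius degree) — companion of `ArchimedeanFSMIProjection.lean`
(tower `N`), same argument: an FSMI-morphism `φ` of `A` projects to a MONOMORPHISM of `D`
(`A.mono_toD_of_isFSMI`) — by condition (a) of (ii) (`A.propII_condA`) when `φ` lies over an
isomorphism of `D₀`; otherwise `φ : P → Q` lies over `Spec ℂ → Spec ℝ`, irreducibility makes the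
angular region of `P` isotropic (naive isotropic hull factorization, `C0.exists_hull_fac`), and then
monomorphy descends along the twisted lifts `(τ_w, 1, s_w)`, `s_w^{deg φ} = c · τ_w(c)⁻¹`
(`C0.exists_twist_endo_comp_eq`, `A.mono_toD_of_mono_of_isIsotropic`). With item (i)
(`prop34_i_holds`) and the main clause of (vi) (`prop34_vi_irreducible`): **the FSMI clause of
Prop. 3.4 (vi) holds AS TYPED for `F = A` over every base** (`A.propVI_FSMI`), without item (iii).
No statement of the paper is strengthened; no side is taken on [IUTchIII] Cor. 3.12.
-/

namespace Literature.AlgebraicGeometry.Frobenioids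

open CategoryTheory Set
open scoped Pointwise

noncomputable section

namespace ArchFrd

universe v u

variable {D : Type u} [Category.{v} D] (π : D ⥤ D0)

/-! ### The tower `A`: FSMI-morphisms project to monomorphisms of `D` -/

/-- **Monomorphy descends for `A`, complex isotropic domain over a real codomain.** Over an arbitrary
base `π : D ⥤ D₀`: a monomorphism `φ : P → Q` of `A` with `P = ((Spec ℂ, A_P), P_D, ι_P)`, `A_P`
isotropic, and `Q` over `Spec ℝ` projects to a monomorphism `φ_D` of `D` — two arrows `u, v : E → P_D`
with `u ≫ φ_D = v ≫ φ_D` lift to isometries of `C` out of `((Spec ℂ, A_P), E, ·)` with equal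
composites with `φ` (`C0.exists_twist_endo_comp_eq`, `s^{deg φ} = c · τ(c)⁻¹`).
[cite: MochizukiFrdII2008, Prop 3.4 (vi) p.30] -/
theorem A.mono_toD_of_mono_of_isIsotropic {RP : AngularRegion ℂ}
    (hRP : D0.complex = D0.real → RP.IsIsotropic) (hisoP : RP.IsIsotropic) {PD : D}
    (ιP : (PreFrobenioid.baseFunctor C0.toElem).obj (C0.mk D0.complex RP hRP) ≅ π.obj PD)
    {RQ : AngularRegion ℂ} (hRQ : D0.real = D0.real → RQ.IsIsotropic) {QD : D}
    (ιQ : (PreFrobenioid.baseFunctor C0.toElem).obj (C0.mk D0.real RQ hRQ) ≅ π.obj QD)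
    (φ : (⟨⟨C0.mk D0.complex RP hRP, PD, ιP⟩⟩ : A π) ⟶ ⟨⟨C0.mk D0.real RQ hRQ, QD, ιQ⟩⟩)
    [Mono φ] : Mono ((towerA π).toD.map φ) := by
  refine ⟨fun {E} u v huv => ?_⟩
  change u ≫ φ.hom.snd = v ≫ φ.hom.snd at huv
  set φ0 := φ.hom.fst with hφ0def
  -- `E` lies over `Spec ℂ`
  have hE : π.obj E = D0.complex :=
    D0.eq_complex_of_hom_complex (π.map u ≫ ιP.inv : π.obj E ⟶ D0.complex)
  let ιV : (PreFrobenioid.baseFunctor C0.toElem).obj (C0.mk D0.complex RP hRP) ≅ π.obj E :=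
    eqToIso hE.symm
  let VC : C π := ⟨C0.mk D0.complex RP hRP, E, ιV⟩
  let V : A π := ⟨VC⟩
  let PC : C π := ⟨C0.mk D0.complex RP hRP, PD, ιP⟩
  let P : A π := ⟨PC⟩
  -- the lift of an arrow `w : E → P_D` to an arrow `V → P` of `A` with composite `φ₀` downstairs
  have lift : ∀ w : E ⟶ PD, ∃ x : V ⟶ P, x.hom.fst ≫ φ0 = φ0 ∧ x.hom.snd = w := by
    intro w
    obtain ⟨x0, hb, -, hI, hcomp⟩ :=
      C0.exists_twist_endo_comp_eq hRP hisoP hRQ φ0 (ιV.hom ≫ π.map w ≫ ιP.inv)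
    have sq : (PreFrobenioid.baseFunctor C0.toElem).map x0 ≫ ιP.hom = ιV.hom ≫ π.map w := by
      have hb' : (PreFrobenioid.baseFunctor C0.toElem).map x0 = ιV.hom ≫ π.map w ≫ ιP.inv := hb
      rw [hb', Category.assoc, Category.assoc, ιP.inv_hom_id, Category.comp_id]
    let xC : VC ⟶ PC := ⟨x0, w, sq⟩
    have hxiso : PreFrobenioid.isometricMorphisms (C.toElem π) xC := hI
    exact ⟨⟨xC, hxiso⟩, hcomp, rfl⟩
  obtain ⟨a, ha0, haD⟩ := lift u
  obtain ⟨b, hb0, hbD⟩ := lift v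
  have hab : a ≫ φ = b ≫ φ := by
    apply WideSubcategory.hom_ext
    refine CFP.hom_ext ?_ ?_
    · show a.hom.fst ≫ φ0 = b.hom.fst ≫ φ0
      rw [ha0, hb0]
    · show a.hom.snd ≫ φ.hom.snd = b.hom.snd ≫ φ.hom.snd
      rw [haD, hbD]
      exact huv
  have h := congrArg (fun f => f.hom.snd) ((cancel_mono φ).mp hab)
  simp only [haD, hbD] at h
  exact h

/-- **An FSMI-morphism of `A` projects to a monomorphism of `D`**, over an arbitrary base
`π : D ⥤ D₀`. If `φ` projects to an isomorphism of `D₀` this is condition (a) of Prop. 3.4 (ii)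
(`A.propII_condA`). Otherwise `φ : P → Q` lies over `Spec ℂ → Spec ℝ`; the angular region of `P` is
isotropic — else `φ` factors through the naive isotropic hull of `P` (`C0.exists_hull_fac`) with
neither factor invertible, contradicting irreducibility — and then monomorphy descends
(`A.mono_toD_of_mono_of_isIsotropic`). [cite: MochizukiFrdII2008, Prop 3.4 (vi) p.30] -/
theorem A.mono_toD_of_isFSMI {P Q : A π} (φ : P ⟶ Q) (hφ : IsFSMI φ) :
    Mono ((towerA π).toD.map φ) := by
  by_cases hA : IsIso ((towerA π).toD0.map φ)
  · exact A.propII_condA π φ hφ.1.2 hA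
  obtain ⟨⟨⟨KP, RP, hRP⟩, PD, ιP⟩⟩ := P
  obtain ⟨⟨⟨KQ, RQ, hRQ⟩, QD, ιQ⟩⟩ := Q
  set φ0 := φ.hom.fst with hφ0def
  -- the base arrow of `φ₀` is not invertible, so it is `Spec ℂ → Spec ℝ`
  have hB : ¬ IsIso ((PreFrobenioid.baseFunctor C0.toElem).map φ0) := by
    intro h
    apply hA
    have hw : (PreFrobenioid.baseFunctor C0.toElem).map φ0 ≫ ιQ.hom = ιP.hom ≫ π.map φ.hom.snd :=
      φ.hom.w
    change IsIso (π.map φ.hom.snd)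
    rw [← (Iso.inv_comp_eq ιP).mpr hw]
    infer_instance
  have hKP : KP = D0.complex := (D0.eq_of_not_isIso (C0.Base φ0) hB).1
  have hKQ : KQ = D0.real := (D0.eq_of_not_isIso (C0.Base φ0) hB).2
  subst hKP hKQ
  haveI := hφ.1.2
  by_cases hisoP : RP.IsIsotropic
  · exact A.mono_toD_of_mono_of_isIsotropic π hRP hisoP ιP hRQ ιQ φ
  · -- factor through the naive isotropic hull: neither factor is an isomorphism
    exfalso
    have hI : PreFrobenioid.IsIsometry C0.toElem φ0 := φ.property
    obtain ⟨β0, α0, hβα, hbβ, -, hβI, -, hαI⟩ := C0.exists_hull_fac hRP hRQ φ0 hI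
    let RP' : AngularRegion ℂ := AngularRegion.isotropicOfTip RP.tip
    have hRP' : D0.complex = D0.real → RP'.IsIsotropic := fun h => nomatch h
    let PC : C π := ⟨C0.mk D0.complex RP hRP, PD, ιP⟩
    let PA : A π := ⟨PC⟩
    let P'C : C π := ⟨C0.mk D0.complex RP' hRP', PD, ιP⟩
    let P' : A π := ⟨P'C⟩
    let QC : C π := ⟨C0.mk D0.real RQ hRQ, QD, ιQ⟩
    let QA : A π := ⟨QC⟩
    have sqβ : (PreFrobenioid.baseFunctor C0.toElem).map β0 ≫ ιP.hom = ιP.hom ≫ π.map (𝟙 PD) := by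
      show C0.Base β0 ≫ ιP.hom = ιP.hom ≫ π.map (𝟙 PD)
      rw [hbβ, π.map_id]
      exact (Category.id_comp _).trans (Category.comp_id _).symm
    let βC : PC ⟶ P'C := ⟨β0, 𝟙 PD, sqβ⟩
    have hβiso : PreFrobenioid.isometricMorphisms (C.toElem π) βC := hβI
    let β : PA ⟶ P' := ⟨βC, hβiso⟩
    have wα : (PreFrobenioid.baseFunctor C0.toElem).map α0 ≫ ιQ.hom = ιP.hom ≫ π.map φ.hom.snd := by
      have hw : (PreFrobenioid.baseFunctor C0.toElem).map φ0 ≫ ιQ.hom = ιP.hom ≫ π.map φ.hom.snd :=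
        φ.hom.w
      have hbα : C0.Base α0 = C0.Base φ0 :=
        (D0.hom_complex_real_eq _).trans (D0.hom_complex_real_eq _).symm
      change C0.Base α0 ≫ ιQ.hom = ιP.hom ≫ π.map φ.hom.snd
      rw [hbα]
      exact hw
    let αC : P'C ⟶ QC := ⟨α0, φ.hom.snd, wα⟩
    have hαiso : PreFrobenioid.isometricMorphisms (C.toElem π) αC := hαI
    let α : P' ⟶ QA := ⟨αC, hαiso⟩
    have hfac : β ≫ α = φ := by
      apply WideSubcategory.hom_ext
      exact CFP.hom_ext hβα (Category.id_comp _)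
    rcases hφ.2.2 β α hfac with hα | hβ
    · haveI := hα
      exact (D0.isEmpty_hom_real_complex.false (C0.Base (inv α).hom.fst)).elim
    · haveI := hβ
      exact C0.not_isIsotropic_elim hRP hisoP (inv β).hom.fst

/-- **Proposition 3.4 (vi), FSMI clause, for `F = A` — PROVED AS TYPED over every base**:
"FSMI-morphisms of `F` project to either isomorphisms or FSMI-morphisms of `D`" — fiberwise-surjective
by item (i) (`prop34_i_holds`), mono by `A.mono_toD_of_isFSMI`, irreducible-or-invertible by the main
clause of (vi) (`prop34_vi_irreducible`). [cite: MochizukiFrdII2008, Prop 3.4 (vi) p.30] -/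
theorem A.propVI_FSMI : (towerA π).PropVI_FSMI := by
  intro P Q φ hφ
  rcases (prop34_vi_irreducible π).1 φ hφ.2 with hiso | hirr
  · exact Or.inl hiso
  · exact Or.inr ⟨⟨(prop34_i_holds π).1 φ hφ.1.1, A.mono_toD_of_isFSMI π φ hφ⟩, hirr⟩

end ArchFrd

end

end Literature.AlgebraicGeometry.Frobenioids
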